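import Summits.BirchSwinnertonDyer.BirchSwinnertonDyer.Theorems.PrintCFramBottomClassIndexLawFiveLeRegularLocusBottomLayer
import Literature.NumberTheory.EllipticCurves.ComplexMultiplicationShaRubinInflationProofs
import Summits.BirchSwinnertonDyer.BirchSwinnertonDyer.Theorems.PrintCFramBottomClassIndexLawFiveLeBorelH1Vanishing
import HarnessLib

/-!
# Crux `PrintCFram.BottomClassIndexLawFiveLe` (stmt-BirchSwinnertonDyer-20372), line `eisenstein-resource-bdp-line` (v10):
# Stub H, typing item T2 — restriction to the splitting field of a line of order `p` is INJECTIVE on `H¹`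

Cell `bsd-print-cfram`, LEAD seat `bsd-line-cfram-p1` (generation g7), `--supports stmt-BirchSwinnertonDyer-20372` (helper).
THEOREMS ONLY (generic group cohomology + its reading on the class's objects); no definition, no named fact, no `sorry`.
BSD is not proved by any of this; no summit statement is proved by this seat.

WHAT. Stub H of the v10 skeleton (`stub_bottomResidualSelmer_trivial_of_bernoulliPair`, adopted from bsd-idea-7 g7's line
`herbrand_regular_locus`) bounds the bottom-layer residual Selmer groups `R_𝔭^S(K'', Φ)`, `R_𝔭^S(K'', W[p]/Φ)` of a `Γ_{K''}`-stable
line `Φ` of order `p`. Step M1 §2 of its anatomy (`Lines/herbrand-regular-locus-M1-anatomy.md`) is the inflation–restriction step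
«`H¹(K'', 𝔽_p(θ)) ↪ Hom(Γ_L, 𝔽_p)` for `L = K''(θ)`, because `p ∤ [L : K'']`». This file proves that step in the tree's currency and
WITHOUT the degree argument: for ANY discrete `G`-module `A` of prime order `p` with continuous orbit maps on which `G` acts
non-trivially, the restriction `H¹(G, A) → H¹(N, A)` to the kernel `N = ker(G → Aut A)` of the action is injective
(`subgroupResKer A N = ⊥`). Mechanism: every `g` acts on the cyclic group `A` as an INTEGER scalar, so `G/N` is abelian; a
`g₀ ∉ N` acts as a scalar `c ≠ 1` of the field `𝔽_p`, so `c − 1` is a unit and Sah's lemma in Rubin's form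
(`Rubin1987.subgroupResKer_eq_bot_of_smul_eq_smul`, tree) applies. Then the reading on the class: for an elliptic curve `E`
over a number field `K` and a `Γ_K`-stable `Φ ≤ E[p]` with `#Φ = p`, both `Φ` and `E[p]/Φ` qualify as soon as SOME element acts
non-trivially on them — which the v10 composition's no-fixed-vector clauses (`IsogenyLineData.exists_line_noFixed_of_isogeny`)
supply.

* `exists_smul_eq_zsmul_of_card_prime` — on a `G`-module of prime order every `g` acts as an integer scalar.
* `exists_character_of_card_prime` — the action on a module of prime order is through a character `θ : G →* (ℤ/p)ˣ` (existence;
  the tree's `Mazur1978.exists_isogenyCharacter` for abstract modules such as `Φ.Sub`, `Φ.Quot` over `K''`).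
* `index_ker_toPermHom_dvd` — `[G : N] ∣ p − 1` for `N` the kernel of the action («`p ∤ |Δ|`»).
* `subgroupResKer_ker_eq_bot_of_card_prime` — THE generic injectivity (T2).
* `subgroupResKer_ker_eq_bot_sub` / `subgroupResKer_ker_eq_bot_quot` — for a stable line `Φ ≤ E[p]` of order `p` and its quotient.
* `subgroupResKer_ker_eq_bot_of_cmRamified` — ON THE CLASS with Stub H's exact quantifiers: for `W` CM, `CMRamified W p`, `5 ≤ p`, ANY
  quadratic `K` and ANY stable `Φ ≤ W_K[p]` of order `p`, BOTH kernels vanish — non-triviality for free from the central homothety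
  `d ≢ 1 (mod p)` in `ρ̄(Γ_K)` (w2 g5 `BorelHomothety.exists_central_homothety_of_cmRamified`, from w4 g2's inertia homothety).

References: Rubin, *Elliptic curves with complex multiplication and the conjecture of Birch and Swinnerton-Dyer* (1999) Lemma 6.2 (i)
(Sah's lemma); Serre, *Galois Cohomology* I.§2.6 (inflation–restriction); Greenberg, LNM 1716 §3 (residual Selmer groups of characters);
the herbrand line card and M1 memo (crux workfiles).
-/

noncomputable section

-- summit-side namespace `Summit.BirchSwinnertonDyer.BirchSwinnertonDyer.…` (single-conjunct summit, D-0017 layout)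
set_option linter.dupNamespace false
set_option autoImplicit false

open scoped Classical
open NumberField WeierstrassCurve
open Literature.NumberTheory.EllipticCurves
open Summit.BirchSwinnertonDyer.Rank1Residual

namespace Summit.BirchSwinnertonDyer.BirchSwinnertonDyer.Theorems.PrintCFram.HerbrandLineRestriction

/-! ## §1 A module of prime order: every group element acts as an integer scalar -/

section PrimeOrder

variable {p : ℕ} [hp : Fact p.Prime]
variable {G : Type} [Group G] {A : Type} [AddCommGroup A] [DistribMulAction G A]

/-- In an additive group of prime order `p`, every non-zero element generates. [folklore] -/
theorem zmultiples_eq_top_of_card_prime (hcard : Nat.card A = p) {x : A} (hx : x ≠ 0) :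
    AddSubgroup.zmultiples x = ⊤ := by
  haveI : Finite A := Nat.finite_of_card_ne_zero (by rw [hcard]; exact hp.out.ne_zero)
  have hord : addOrderOf x ∣ p := by rw [← hcard]; exact addOrderOf_dvd_natCard x
  rcases (Nat.dvd_prime hp.out).mp hord with h1 | hpx
  · exact absurd (AddMonoid.addOrderOf_eq_one_iff.mp h1) hx
  · apply AddSubgroup.eq_top_of_card_eq
    rw [Nat.card_zmultiples, hpx, hcard]

/-- **Scalar action on a module of prime order.** If `#A = p` then every `g ∈ G` acts on `A` as an INTEGER scalar:
`∃ a : ℤ, ∀ x, g • x = a • x` (take a generator `x₀`; `g • x₀ = a • x₀`; additivity). [folklore] -/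
theorem exists_smul_eq_zsmul_of_card_prime (hcard : Nat.card A = p) (g : G) :
    ∃ a : ℤ, ∀ x : A, g • x = a • x := by
  haveI : Finite A := Nat.finite_of_card_ne_zero (by rw [hcard]; exact hp.out.ne_zero)
  have h1 : 1 < Nat.card A := by rw [hcard]; exact hp.out.one_lt
  obtain ⟨x₀, hx₀⟩ : ∃ x₀ : A, x₀ ≠ 0 := by
    haveI : Nontrivial A := Finite.one_lt_card_iff_nontrivial.mp h1
    exact exists_ne 0
  have htop := zmultiples_eq_top_of_card_prime hcard hx₀
  have hgen : ∀ x : A, ∃ k : ℤ, k • x₀ = x := fun x ↦ by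
    have hx : x ∈ AddSubgroup.zmultiples x₀ := by rw [htop]; exact AddSubgroup.mem_top x
    exact AddSubgroup.mem_zmultiples_iff.mp hx
  obtain ⟨a, ha⟩ := hgen (g • x₀)
  refine ⟨a, fun x ↦ ?_⟩
  obtain ⟨k, rfl⟩ := hgen x
  rw [smul_comm g k x₀, ← ha, smul_smul, smul_smul, mul_comm]

/-- Hence the action factors through an ABELIAN quotient: `g h` and `h g` act alike. [folklore] -/
theorem mul_smul_comm_of_card_prime (hcard : Nat.card A = p) (g h : G) (x : A) :
    (g * h) • x = (h * g) • x := by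
  obtain ⟨a, ha⟩ := exists_smul_eq_zsmul_of_card_prime hcard g
  obtain ⟨b, hb⟩ := exists_smul_eq_zsmul_of_card_prime hcard h
  rw [mul_smul, mul_smul, hb x, ha x, ha (b • x), hb (a • x), smul_smul, smul_smul, mul_comm]

omit hp in
/-- Elements of a module of prime order `p` are `p`-torsion. [folklore] -/
theorem prime_nsmul_eq_zero_of_card_prime (hcard : Nat.card A = p) (x : A) : p • x = 0 := by
  have h := addOrderOf_dvd_natCard x
  rw [hcard] at h
  exact addOrderOf_dvd_iff_nsmul_eq_zero.mp h

end PrimeOrder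


/-! ## §1b The character of a module of prime order (existence as a homomorphism; no definition minted) -/

section Character

variable {p : ℕ} [hp : Fact p.Prime]
variable {G : Type} [Group G] {A : Type} [AddCommGroup A] [DistribMulAction G A]

omit hp in
/-- Integer scalars that agree on a non-zero element of a group of prime order `p` are congruent mod `p`. [folklore] -/
theorem intCast_eq_of_zsmul_eq [Fact p.Prime] (hcard : Nat.card A = p) {x : A} (hx : x ≠ 0) {a b : ℤ}
    (h : a • x = b • x) : (a : ZMod p) = (b : ZMod p) := by
  have h0 : (a - b) • x = 0 := by rw [sub_smul, h, sub_self]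
  have hdvd : (p : ℤ) ∣ a - b := by
    haveI : Finite A := Nat.finite_of_card_ne_zero (by rw [hcard]; exact (Fact.out : p.Prime).ne_zero)
    have hord : addOrderOf x ∣ p := by rw [← hcard]; exact addOrderOf_dvd_natCard x
    have hp' : addOrderOf x = p := by
      rcases (Nat.dvd_prime (Fact.out : p.Prime)).mp hord with h1 | h1
      · exact absurd (AddMonoid.addOrderOf_eq_one_iff.mp h1) hx
      · exact h1
    rw [← hp']
    exact addOrderOf_dvd_iff_zsmul_eq_zero.mpr h0
  exact (ZMod.intCast_eq_intCast_iff_dvd_sub a b p).mpr (by rw [← neg_sub]; exact (dvd_neg).mpr hdvd)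

/-- In a group of prime order `p`, integer scalars congruent mod `p` act alike. [folklore] -/
theorem zsmul_eq_zsmul_of_intCast_eq (hcard : Nat.card A = p) {a b : ℤ} (h : (a : ZMod p) = (b : ZMod p)) (x : A) :
    a • x = b • x := by
  have hdvd : (p : ℤ) ∣ b - a := (ZMod.intCast_eq_intCast_iff_dvd_sub a b p).mp h
  obtain ⟨c, hc⟩ := hdvd
  have hpx : (p : ℤ) • x = 0 := by
    rw [natCast_zsmul]; exact prime_nsmul_eq_zero_of_card_prime hcard x
  calc a • x = a • x + c • ((p : ℤ) • x) := by rw [hpx, smul_zero, add_zero]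
    _ = b • x := by rw [smul_smul, ← add_smul, mul_comm, ← hc]; congr 1; ring

/-- **The character of a module of prime order.** If `#A = p` then the action of `G` on `A` is through a CHARACTER
`θ : G →* (ℤ/p)ˣ`: `g • x = θ(g) • x` (the scalar read as a natural number `< p`), and `ker θ` is the kernel of the action.
(For the stable line `Φ` of `W[p]` over `ℚ` this is Mazur's isogeny character `Mazur1978.exists_isogenyCharacter`; here for an
abstract module, e.g. `Φ.Sub`, `Φ.Quot` over `K''`.) Existence only — no definition is minted. [folklore]
[cite: Mazur1978, §5 (p. 148, the isogeny character)] -/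
theorem exists_character_of_card_prime (hcard : Nat.card A = p) :
    ∃ θ : G →* (ZMod p)ˣ, (∀ (g : G) (x : A), g • x = (((θ g : ZMod p).val : ℕ) : ℤ) • x) ∧
      (∀ g : G, θ g = 1 ↔ ∀ x : A, g • x = x) := by
  haveI : Finite A := Nat.finite_of_card_ne_zero (by rw [hcard]; exact hp.out.ne_zero)
  haveI : Nontrivial A := Finite.one_lt_card_iff_nontrivial.mp (by rw [hcard]; exact hp.out.one_lt)
  obtain ⟨x₀, hx₀⟩ := exists_ne (0 : A)
  -- the scalar of each `g`, and its non-vanishing mod `p`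
  choose a ha using fun g : G ↦ exists_smul_eq_zsmul_of_card_prime (p := p) hcard g
  have hane : ∀ g : G, (a g : ZMod p) ≠ 0 := by
    intro g h0
    have h0' : (a g : ZMod p) = ((0 : ℤ) : ZMod p) := by rw [h0, Int.cast_zero]
    have := zsmul_eq_zsmul_of_intCast_eq hcard h0' x₀
    rw [← ha g x₀, zero_smul] at this
    exact hx₀ (by simpa using congrArg (fun y ↦ g⁻¹ • y) this)
  haveI : Fact (1 < p) := ⟨hp.out.one_lt⟩
  let θ₀ : G → (ZMod p)ˣ := fun g ↦ Units.mk0 (a g : ZMod p) (hane g)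
  have hθ₀ : ∀ g, ((θ₀ g : (ZMod p)ˣ) : ZMod p) = (a g : ZMod p) := fun g ↦ rfl
  have hmul : ∀ g h : G, θ₀ (g * h) = θ₀ g * θ₀ h := by
    intro g h
    apply Units.ext
    rw [Units.val_mul, hθ₀, hθ₀, hθ₀, ← Int.cast_mul]
    apply intCast_eq_of_zsmul_eq hcard hx₀
    rw [← ha (g * h) x₀, mul_smul, ha h x₀, smul_comm g (a h) x₀, ha g x₀, smul_smul, mul_comm]
  have hone : θ₀ 1 = 1 := by
    apply Units.ext
    rw [hθ₀, Units.val_one, ← Int.cast_one]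
    apply intCast_eq_of_zsmul_eq hcard hx₀
    rw [← ha 1 x₀, one_smul, one_smul]
  refine ⟨MonoidHom.mk' θ₀ hmul, fun g x ↦ ?_, fun g ↦ ?_⟩
  · -- `g • x = (val (a g mod p)) • x`
    rw [MonoidHom.mk'_apply, ha g x]
    apply zsmul_eq_zsmul_of_intCast_eq hcard
    rw [hθ₀, Int.cast_natCast, ZMod.natCast_zmod_val]
  · rw [MonoidHom.mk'_apply]
    constructor
    · intro h1 x
      have hv : (((θ₀ g : ZMod p).val : ℕ) : ℤ) = 1 := by
        rw [h1, Units.val_one, ZMod.val_one]; rfl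
      have := zsmul_eq_zsmul_of_intCast_eq hcard (a := a g) (b := 1) (by rw [← hθ₀, h1, Units.val_one, Int.cast_one]) x
      rw [ha g x, this, one_smul]
    · intro hfix
      apply Units.ext
      rw [hθ₀, Units.val_one, ← Int.cast_one]
      apply intCast_eq_of_zsmul_eq hcard hx₀
      rw [← ha g x₀, hfix x₀, one_smul]


/-- **`p ∤ [G : N]`.** The kernel `N` of the action on a module of prime order `p` has index dividing `p − 1` (the action is
through `θ : G →* (ℤ/p)ˣ`, a group of order `p − 1`) — the «`p ∤ |Δ|`» of the herbrand anatomy (M1 §2), which makes the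
`θ`-eigenspace functor exact in T3/T4. [folklore] [cite: Washington1997, §6.3 (eigenspaces for `p ∤ |G|`)] -/
theorem index_ker_toPermHom_dvd (hcard : Nat.card A = p) :
    ((MulAction.toPermHom G A).ker).index ∣ p - 1 := by
  obtain ⟨θ, -, hker⟩ := exists_character_of_card_prime (G := G) hcard
  have hk : (MulAction.toPermHom G A).ker = θ.ker := by
    ext g
    rw [MonoidHom.mem_ker, MonoidHom.mem_ker, Equiv.ext_iff, hker]
    rfl
  have hu : Nat.card (ZMod p)ˣ = p - 1 := by rw [Nat.card_eq_fintype_card, ZMod.card_units p]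
  rw [hk, Subgroup.index_ker, ← hu]
  exact Subgroup.card_subgroup_dvd_card θ.range

end Character

/-! ## §2 T2: restriction to the kernel of the action is injective on `H¹` -/

section Restriction

variable {p : ℕ} [hp : Fact p.Prime]
variable {G : Type} [Group G] [TopologicalSpace G] [IsTopologicalGroup G]
variable {A : Type} [AddCommGroup A] [DistribMulAction G A] [TopologicalSpace A] [DiscreteTopology A]

omit [TopologicalSpace G] [IsTopologicalGroup G] [TopologicalSpace A] [DiscreteTopology A] in
/-- Membership in the kernel of the action: `g ∈ ker(G → Perm A) ↔ ∀ x, g • x = x`. [folklore] -/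
theorem mem_ker_toPermHom_iff (g : G) : g ∈ (MulAction.toPermHom G A).ker ↔ ∀ x : A, g • x = x := by
  rw [MonoidHom.mem_ker, Equiv.ext_iff]
  rfl

omit [IsTopologicalGroup G] in
/-- The kernel of the action on a FINITE discrete module with continuous orbit maps is OPEN (a finite intersection of
stabilisers, each the preimage of a point of a discrete space). [folklore] -/
theorem isOpen_ker_toPermHom [Finite A] (hcont : ∀ a : A, Continuous fun g : G ↦ g • a) :
    IsOpen (((MulAction.toPermHom G A).ker : Subgroup G) : Set G) := by
  have e : (((MulAction.toPermHom G A).ker : Subgroup G) : Set G) = ⋂ a : A, (fun g : G ↦ g • a) ⁻¹' {a} := by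
    ext g
    simp only [SetLike.mem_coe, mem_ker_toPermHom_iff, Set.mem_iInter, Set.mem_preimage, Set.mem_singleton_iff]
  rw [e]
  exact isOpen_iInter_of_finite fun a ↦ (isOpen_discrete {a}).preimage (hcont a)

/-- **T2 (generic).** Let `A` be a discrete `G`-module of PRIME order `p` with continuous orbit maps on which `G` acts
NON-trivially, and `N = ker(G → Aut A)` (the absolute Galois group of the splitting field `L = K(θ)` when `G = Γ_K`,
`A = 𝔽_p(θ)`). Then restriction `H¹(G, A) → H¹(N, A)` is injective: `subgroupResKer A N = ⊥`. Proof: `G/N` is abelian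
(integer scalars), some `g₀` acts as a scalar `c ≠ 1` of the field `𝔽_p`, `c − 1` is a unit — Sah's lemma in Rubin's form.
[cite: SerreGaloisCohomology1997, I.§2.6 (b)] [cite: GreenbergLNM1716, §3 (PDF p. 86)] -/
theorem subgroupResKer_ker_eq_bot_of_card_prime (hcard : Nat.card A = p)
    (hcont : ∀ a : A, Continuous fun g : G ↦ g • a) (hnt : ∃ (g : G) (a : A), g • a ≠ a) :
    subgroupResKer A (MulAction.toPermHom G A).ker = ⊥ := by
  haveI : Finite A := Nat.finite_of_card_ne_zero (by rw [hcard]; exact hp.out.ne_zero)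
  letI : Module (ZMod p) A := AddCommGroup.zmodModule (prime_nsmul_eq_zero_of_card_prime hcard)
  obtain ⟨g₀, a₁, hg₀⟩ := hnt
  obtain ⟨a, ha⟩ := exists_smul_eq_zsmul_of_card_prime hcard g₀
  have hc : ∀ x : A, g₀ • x = ((a : ℤ) : ZMod p) • x := fun x ↦ by rw [Int.cast_smul_eq_zsmul, ha]
  have hc1 : ((a : ℤ) : ZMod p) ≠ 1 := by
    intro h1
    exact hg₀ (by rw [hc, h1, one_smul])
  have hu : IsUnit (((a : ℤ) : ZMod p) - 1) := isUnit_iff_ne_zero.mpr (sub_ne_zero.mpr hc1)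
  refine Rubin1987.subgroupResKer_eq_bot_of_smul_eq_smul (MulAction.toPermHom G A).ker (isOpen_ker_toPermHom hcont)
    (fun n hn x ↦ (mem_ker_toPermHom_iff n).mp hn x) (fun g h ↦ ⟨(h * g)⁻¹ * (g * h), ?_, by group⟩) hc hu
  rw [mem_ker_toPermHom_iff]
  intro x
  rw [mul_smul, mul_smul_comm_of_card_prime hcard g h x, inv_smul_smul]

end Restriction

/-! ## §3 Reading on the class's objects: a stable line `Φ ≤ E[p]` of order `p` and its quotient -/

section Line

variable {p : ℕ} [hp : Fact p.Prime]
variable {K : Type} [Field K] [NumberField K] (E : WeierstrassCurve K) [E.IsElliptic]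

omit [NumberField K] [E.IsElliptic] in
/-- The orbit maps of `E[p]` are continuous (`E(K̄)` is a discrete `Γ_K`-module). [cite: SerreGaloisCohomology1997, II.§1.1] -/
theorem continuous_smul_geomTorsion (n : ℤ) (P : E.geomTorsion n) :
    Continuous fun g : Field.absoluteGaloisGroup K ↦ g • P :=
  continuous_of_injective_comp (ι := ((↑) : E.geomTorsion n → E.geomPoints)) Subtype.val_injective
    (E.continuous_smul_geomPoints (P : E.geomPoints))

omit [NumberField K] [E.IsElliptic] in
/-- **T2 for the line.** For a `Γ_K`-stable `Φ ≤ E[p]` with `#Φ = p` on which some `σ ∈ Γ_K` acts non-trivially (e.g. the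
isogeny line of the v10 composition, by its no-fixed-vector clause at `ker κ ⊓ D_𝔭`), restriction of `H¹(Γ_K, Φ)` to the absolute
Galois group `N_Φ = ker(Γ_K → Aut Φ)` of the splitting field `K(Φ)` is injective. [cite: SerreGaloisCohomology1997, I.§2.6 (b)]
[cite: GreenbergLNM1716, §3 (PDF p. 86)] -/
theorem subgroupResKer_ker_eq_bot_sub
    (Φ : X2.ResidualDevissageModules.StableSubgroup (Field.absoluteGaloisGroup K) (E.geomTorsion (p : ℤ)))
    (hcard : Nat.card Φ.Sub = p) (hnt : ∃ (σ : Field.absoluteGaloisGroup K) (x : Φ.Sub), σ • x ≠ x) :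
    subgroupResKer Φ.Sub (MulAction.toPermHom (Field.absoluteGaloisGroup K) Φ.Sub).ker = ⊥ :=
  subgroupResKer_ker_eq_bot_of_card_prime hcard (Φ.continuous_smul_sub (continuous_smul_geomTorsion E (p : ℤ))) hnt

/-- The quotient of `E[p]` (order `p²`) by a line of order `p` has order `p`. [folklore] -/
theorem natCard_quot_eq_of_card_sub
    (Φ : X2.ResidualDevissageModules.StableSubgroup (Field.absoluteGaloisGroup K) (E.geomTorsion (p : ℤ)))
    (hcard : Nat.card Φ.Sub = p) : Nat.card Φ.Quot = p := by
  have hM : Nat.card (E.geomTorsion (p : ℤ)) = p ^ 2 := E.natCard_geomTorsion_prime_eq_sq hp.out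
  have h := Φ.natCard_eq_mul
  rw [hM, hcard, sq] at h
  exact (Nat.eq_of_mul_eq_mul_right hp.out.pos h).symm

/-- **T2 for the quotient.** Same for `E[p]/Φ`: if some `σ` acts non-trivially on the quotient line, restriction of
`H¹(Γ_K, E[p]/Φ)` to `ker(Γ_K → Aut(E[p]/Φ))` is injective. [cite: SerreGaloisCohomology1997, I.§2.6 (b)]
[cite: GreenbergLNM1716, §3 (PDF p. 86)] -/
theorem subgroupResKer_ker_eq_bot_quot
    (Φ : X2.ResidualDevissageModules.StableSubgroup (Field.absoluteGaloisGroup K) (E.geomTorsion (p : ℤ)))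
    (hcard : Nat.card Φ.Sub = p) (hnt : ∃ (σ : Field.absoluteGaloisGroup K) (y : Φ.Quot), σ • y ≠ y) :
    subgroupResKer Φ.Quot (MulAction.toPermHom (Field.absoluteGaloisGroup K) Φ.Quot).ker = ⊥ :=
  subgroupResKer_ker_eq_bot_of_card_prime (natCard_quot_eq_of_card_sub E Φ hcard)
    (Φ.continuous_smul_quot (continuous_smul_geomTorsion E (p : ℤ))) hnt

omit [NumberField K] in
/-- **The no-fixed-vector clauses of the v10 composition give the non-triviality.** If no non-zero vector of `Φ` is fixed by
the subgroup `H` (on the class: `H = ker κ ⊓ D_𝔭`, `IsogenyLineData.exists_line_noFixed_of_isogeny`), then — `Φ` having a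
non-zero element — some `σ` acts non-trivially on `Φ`; likewise for the quotient. [folklore] -/
theorem exists_smul_ne_of_noFixed {B : Type} [AddCommGroup B] [DistribMulAction (Field.absoluteGaloisGroup K) B]
    (hcard : Nat.card B = p) (H : Subgroup (Field.absoluteGaloisGroup K))
    (hfix : ∀ x : B, (∀ σ ∈ H, σ • x = x) → x = 0) :
    ∃ (σ : Field.absoluteGaloisGroup K) (x : B), σ • x ≠ x := by
  haveI : Finite B := Nat.finite_of_card_ne_zero (by rw [hcard]; exact hp.out.ne_zero)
  haveI : Nontrivial B := Finite.one_lt_card_iff_nontrivial.mp (by rw [hcard]; exact hp.out.one_lt)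
  obtain ⟨x, hx⟩ := exists_ne (0 : B)
  by_contra h
  exact hx (hfix x fun σ _ ↦ not_not.mp fun hne ↦ h ⟨σ, x, hne⟩)

end Line


/-! ## §4 On the class, with Stub H's quantifiers: every stable line of order `p` over a quadratic field -/

section Class

variable {p : ℕ} [hp : Fact p.Prime]

/-- In an additive group of prime order `p`, a non-zero element killed by the integer `n` forces `p ∣ n`. [folklore] -/
theorem prime_dvd_of_zsmul_eq_zero {B : Type} [AddCommGroup B] (hcard : Nat.card B = p) {x : B} (hx : x ≠ 0) {n : ℤ}
    (hn : n • x = 0) : (p : ℤ) ∣ n := by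
  haveI : Finite B := Nat.finite_of_card_ne_zero (by rw [hcard]; exact hp.out.ne_zero)
  have hord : addOrderOf x ∣ p := by rw [← hcard]; exact addOrderOf_dvd_natCard x
  have hp' : addOrderOf x = p := by
    rcases (Nat.dvd_prime hp.out).mp hord with h1 | h
    · exact absurd (AddMonoid.addOrderOf_eq_one_iff.mp h1) hx
    · exact h
  rw [← hp']
  exact addOrderOf_dvd_iff_zsmul_eq_zero.mpr hn

/-- **T2 ON THE CLASS (Stub H's quantifiers).** For `W/ℚ` with CM, `p ≥ 5` CM-ramified, ANY quadratic field `K` and ANY `Γ_K`-stable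
`Φ ≤ W_K[p]` with `#Φ = p`: restriction to the kernel of the action is injective on `H¹` for BOTH `Φ` and `W_K[p]/Φ`. The non-triviality
is automatic: `ρ̄(Γ_K)` contains a central homothety `d` with `d ≢ 1 (mod p)` (`BorelHomothety.exists_central_homothety_of_cmRamified`,
level `M = 1`), which moves every non-zero vector of `Φ` and of the quotient. This is step M1 §2 of Stub H for every line the stub
quantifies over (no uniqueness-of-the-line argument needed). [cite: SerreGaloisCohomology1997, I.§2.6 (b)]
[cite: GrigorovJorzaPatrikisSteinTarnita2009, Prop. 5.4 (mechanism)] [cite: GreenbergLNM1716, §3 (PDF p. 86)] -/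
theorem subgroupResKer_ker_eq_bot_of_cmRamified (W : WeierstrassCurve ℚ) [W.IsElliptic] (hCM : W.HasCM)
    (hram : Rank1Residual.CMRamified W p) (h5 : 5 ≤ p) (K : Type) [Field K] [NumberField K] (hK2 : Module.finrank ℚ K = 2)
    (Φ : X2.ResidualDevissageModules.StableSubgroup (Field.absoluteGaloisGroup K) ((W.baseChange K).geomTorsion (p : ℤ)))
    (hcard : Nat.card Φ.Sub = p) :
    subgroupResKer Φ.Sub (MulAction.toPermHom (Field.absoluteGaloisGroup K) Φ.Sub).ker = ⊥ ∧
      subgroupResKer Φ.Quot (MulAction.toPermHom (Field.absoluteGaloisGroup K) Φ.Quot).ker = ⊥ := by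
  haveI hE : (W.baseChange K).IsElliptic := by unfold WeierstrassCurve.baseChange; infer_instance
  obtain ⟨g₀, d, hcop, hg₀⟩ :=
    BorelHomothety.exists_central_homothety_of_cmRamified W p K hCM h5 hram hK2 (M := 1) le_rfl
  -- `g₀` acts as the integer `d` on `W_K[p]`
  have hg : ∀ P : (W.baseChange K).geomTorsion (p : ℤ), g₀ • P = d • P := by
    intro P
    have hmem : (P : (W.baseChange K).geomPoints) ∈ (W.baseChange K).geomTorsion ((p ^ 1 : ℕ) : ℤ) := by
      rw [pow_one]; exact P.2
    have h := congrArg Subtype.val (hg₀ ⟨P, hmem⟩)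
    exact Subtype.ext h
  -- `p ∤ d − 1`
  have hpd : ¬ (p : ℤ) ∣ d - 1 := by
    intro h
    have hu : IsUnit (((p ^ 1 : ℕ) : ℤ)) := by
      have hc : IsCoprime (((p ^ 1 : ℕ) : ℤ)) (((p ^ 1 : ℕ) : ℤ)) :=
        hcop.of_isCoprime_of_dvd_left (by rw [pow_one]; exact h)
      exact isCoprime_self.mp hc
    rw [pow_one, Int.isUnit_iff_natAbs_eq, Int.natAbs_natCast] at hu
    exact hp.out.one_lt.ne' hu
  -- non-triviality on `Φ`
  have hntS : ∃ (σ : Field.absoluteGaloisGroup K) (x : Φ.Sub), σ • x ≠ x := by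
    haveI : Finite Φ.Sub := Nat.finite_of_card_ne_zero (by rw [hcard]; exact hp.out.ne_zero)
    haveI : Nontrivial Φ.Sub := Finite.one_lt_card_iff_nontrivial.mp (by rw [hcard]; exact hp.out.one_lt)
    obtain ⟨x, hx⟩ := exists_ne (0 : Φ.Sub)
    refine ⟨g₀, x, fun h ↦ hpd (prime_dvd_of_zsmul_eq_zero hcard hx (n := d - 1) ?_)⟩
    have hdx : g₀ • x = d • x := Φ.incl_injective (by rw [Φ.incl_smul, map_zsmul, hg])
    rw [sub_smul, one_smul, ← hdx, h, sub_self]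
  -- non-triviality on the quotient (order `p` as well)
  have hcardQ : Nat.card Φ.Quot = p := natCard_quot_eq_of_card_sub (W.baseChange K) Φ hcard
  have hntQ : ∃ (σ : Field.absoluteGaloisGroup K) (y : Φ.Quot), σ • y ≠ y := by
    haveI : Finite Φ.Quot := Nat.finite_of_card_ne_zero (by rw [hcardQ]; exact hp.out.ne_zero)
    haveI : Nontrivial Φ.Quot := Finite.one_lt_card_iff_nontrivial.mp (by rw [hcardQ]; exact hp.out.one_lt)
    obtain ⟨y, hy⟩ := exists_ne (0 : Φ.Quot)
    refine ⟨g₀, y, fun h ↦ hpd (prime_dvd_of_zsmul_eq_zero hcardQ hy (n := d - 1) ?_)⟩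
    obtain ⟨m, rfl⟩ := Φ.proj_surjective y
    have hdy : g₀ • Φ.proj m = d • Φ.proj m := by rw [Φ.smul_proj, hg, map_zsmul]
    rw [sub_smul, one_smul, ← hdy, h, sub_self]
  exact ⟨subgroupResKer_ker_eq_bot_sub (W.baseChange K) Φ hcard hntS,
    subgroupResKer_ker_eq_bot_quot (W.baseChange K) Φ hcard hntQ⟩

end Class

end Summit.BirchSwinnertonDyer.BirchSwinnertonDyer.Theorems.PrintCFram.HerbrandLineRestriction

end
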